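import Literature.Computability.QuantumComplexity.PeriodFindingFourier
import HarnessLib

/-!
# Boneh–Lipton period finding read out by Kitaev's Hadamard tests, IV: factorisation of fibre sums

Topic `Literature/Computability/QuantumComplexity`; algebra behind the read-out law of the
period-finding family of `Literature/Barriers/QuantumAdvantage/PPolyOraclesLem75Law.lean`
(discharge of `aaronsonChen2017_lem75_quantum`). Kitaev's amplitude of a coin assignment is a
product of one-coin factors and the classical block acts blockwise, so the fibre norm-sums
`∑_ω |∑_{y : g(y) = ω} ∏_i φ_i(y_i)|²` factorise (Kitaev 1995, §3, Lemma 8 (3): measurements with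
disjoint additional registers multiply):

* `fiber_norm_sq_blocks` — over blocks of coins (`Finset.prod_univ_sum` twice);
* `fiber_norm_sq_idle` — coins the fibre map ignores contribute the constant `∏ |φ(0) + φ(1)|²`;
* `sum_fiber_norm_sq_active(_signChar)` — the active coins of a period-finding block, presented as
  offsets `Fin b` and controls `J`, obey the read-out identity of `PeriodFindingFourier.lean`.

## References

* A. Yu. Kitaev, arXiv:quant-ph/9511026 (1995), §3 Lemma 8 [Kitaev1995].
* M. A. Nielsen, I. L. Chuang, *Quantum Computation and Quantum Information*, CUP 2010, §2.2.8 [NielsenChuang2010].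
-/

noncomputable section

namespace Literature.Computability.QuantumComplexity

namespace PeriodFinding

open Finset Literature.Computability.Cryptography Literature.Computability.Cryptography.Kitaev1995

/-! ### Blocks: the fibre norm-sum of a blockwise map is the product of the blocks' -/

section Blocks

variable {ι Cell : Type*} [Fintype ι] [DecidableEq ι] [Fintype Cell] [DecidableEq Cell]
  {F : Cell → Type*} [∀ s, Fintype (F s)] [∀ s, DecidableEq (F s)]
  {Ω : Cell → Type*} [∀ s, Fintype (Ω s)] [∀ s, DecidableEq (Ω s)]

/-- Splitting an assignment of the coins into the assignments of the blocks along
`e : ι ≃ Σ s, F s`. [folklore] -/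
def blockSplit (e : ι ≃ Σ s, F s) : (ι → Bool) ≃ (∀ s : Cell, F s → Bool) :=
  ((Equiv.arrowCongr e (Equiv.refl Bool)).trans (Equiv.piCurry fun _ _ => Bool))

omit [Fintype ι] [DecidableEq ι] [Fintype Cell] [DecidableEq Cell] [∀ s, Fintype (F s)] [∀ s, DecidableEq (F s)] in
/-- The block assignment reads the coins of the block. [folklore] -/
@[simp] theorem blockSplit_apply (e : ι ≃ Σ s, F s) (y : ι → Bool) (s : Cell) (j : F s) :
    blockSplit e y s j = y (e.symm ⟨s, j⟩) := rfl

/-- **Blockwise fibre maps factorise.** If the coins split into blocks along `e`, the amplitude of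
an assignment is the product of one-coin factors `φ i (y i)`, and the fibre condition is a
conjunction of conditions on the blocks (`g s` on the coins of block `s`), then the fibre norm-sum
is the product over the blocks of the blocks' fibre norm-sums (measurements with disjoint
registers multiply, Kitaev 1995, §3, Lemma 8 (3); Nielsen–Chuang 2010, §2.2.8).
[cite: Kitaev1995, §3 Lemma 8] -/
theorem fiber_norm_sq_blocks (e : ι ≃ Σ s, F s) (φ : ι → Bool → ℂ)
    (g : (s : Cell) → (F s → Bool) → Ω s) :
    ∑ ω : (∀ s, Ω s), ‖∑ y ∈ univ.filter (fun y : ι → Bool => ∀ s, g s (fun j => y (e.symm ⟨s, j⟩)) = ω s),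
        ∏ i, φ i (y i)‖ ^ 2 =
      ∏ s, ∑ ωs : Ω s, ‖∑ ys ∈ univ.filter (fun ys : F s → Bool => g s ys = ωs),
        ∏ j, φ (e.symm ⟨s, j⟩) (ys j)‖ ^ 2 := by
  classical
  -- transport the assignments to block assignments
  have hinner : ∀ ω : (∀ s, Ω s),
      (∑ y ∈ univ.filter (fun y : ι → Bool => ∀ s, g s (fun j => y (e.symm ⟨s, j⟩)) = ω s), ∏ i, φ i (y i)) =
        ∏ s, ∑ ys ∈ univ.filter (fun ys : F s → Bool => g s ys = ω s), ∏ j, φ (e.symm ⟨s, j⟩) (ys j) := by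
    intro ω
    rw [prod_univ_sum]
    -- the filtered sum over `y` as a sum over `Y = blockSplit e y`
    have h1 : (∑ y ∈ univ.filter (fun y : ι → Bool => ∀ s, g s (fun j => y (e.symm ⟨s, j⟩)) = ω s), ∏ i, φ i (y i)) =
        ∑ y : ι → Bool, if (∀ s, g s (blockSplit e y s) = ω s) then ∏ i, φ i (y i) else 0 := by
      rw [sum_filter]; rfl
    have h2 : (∑ Y ∈ Fintype.piFinset (fun s => univ.filter (fun ys : F s → Bool => g s ys = ω s)),
        ∏ s, ∏ j, φ (e.symm ⟨s, j⟩) (Y s j)) =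
        ∑ Y : (∀ s, F s → Bool), if (∀ s, g s (Y s) = ω s) then ∏ s, ∏ j, φ (e.symm ⟨s, j⟩) (Y s j) else 0 := by
      rw [← sum_filter]
      congr 1
      ext Y
      simp [Fintype.mem_piFinset]
    rw [h1, h2]
    refine Fintype.sum_equiv (blockSplit e) _ _ fun y => ?_
    congr 1
    -- the amplitude regrouped by blocks
    rw [← Fintype.prod_equiv e.symm (fun p => φ (e.symm p) (y (e.symm p))) (fun i => φ i (y i)) (fun _ => rfl),
      Fintype.prod_sigma]
    rfl
  simp_rw [hinner, norm_prod, ← prod_pow]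
  symm
  rw [prod_univ_sum, Fintype.piFinset_univ]

end Blocks

/-! ### Idle coins: coordinates the fibre map ignores contribute a constant factor -/

section Idle

variable {Fs A I Ω : Type*} [Fintype Fs] [DecidableEq Fs] [Fintype A] [DecidableEq A] [Fintype I]
  [DecidableEq I] [Fintype Ω] [DecidableEq Ω]

/-- **Idle coins factor out.** If the coins of a block split as active `A` and idle `I` along
`e : Fs ≃ A ⊕ I` and the fibre map only reads the active ones, the fibre norm-sum is the constant
`∏_{i idle} |φ_i(0) + φ_i(1)|²` times the fibre norm-sum of the active coins.
[cite: Kitaev1995, §3 Lemma 8] -/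
theorem fiber_norm_sq_idle (e : Fs ≃ A ⊕ I) (φ : Fs → Bool → ℂ) (g : (A → Bool) → Ω) :
    ∑ ω : Ω, ‖∑ y ∈ univ.filter (fun y : Fs → Bool => g (fun a => y (e.symm (Sum.inl a))) = ω), ∏ j, φ j (y j)‖ ^ 2 =
      (∏ i : I, ‖φ (e.symm (Sum.inr i)) false + φ (e.symm (Sum.inr i)) true‖ ^ 2) *
        ∑ ω : Ω, ‖∑ ya ∈ univ.filter (fun ya : A → Bool => g ya = ω), ∏ a, φ (e.symm (Sum.inl a)) (ya a)‖ ^ 2 := by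
  classical
  set E : (Fs → Bool) ≃ (A → Bool) × (I → Bool) :=
    (Equiv.arrowCongr e (Equiv.refl Bool)).trans (Equiv.sumArrowEquivProdArrow A I Bool) with hE
  have hE1 : ∀ (y : Fs → Bool), (E y).1 = fun a => y (e.symm (Sum.inl a)) := fun _ => rfl
  have hE2 : ∀ (y : Fs → Bool), (E y).2 = fun i => y (e.symm (Sum.inr i)) := fun _ => rfl
  -- the idle sum
  have hidle : (∑ yi : I → Bool, ∏ i, φ (e.symm (Sum.inr i)) (yi i)) =
      ∏ i : I, (φ (e.symm (Sum.inr i)) false + φ (e.symm (Sum.inr i)) true) :=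
    sum_pi_bool_prod fun i c => φ (e.symm (Sum.inr i)) c
  have hinner : ∀ ω : Ω,
      (∑ y ∈ univ.filter (fun y : Fs → Bool => g (fun a => y (e.symm (Sum.inl a))) = ω), ∏ j, φ j (y j)) =
        (∑ ya ∈ univ.filter (fun ya : A → Bool => g ya = ω), ∏ a, φ (e.symm (Sum.inl a)) (ya a)) *
          ∏ i : I, (φ (e.symm (Sum.inr i)) false + φ (e.symm (Sum.inr i)) true) := by
    intro ω
    rw [sum_filter, sum_filter, ← hidle, sum_mul_sum, ← Fintype.sum_prod_type']
    refine Fintype.sum_equiv E _ _ fun y => ?_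
    simp only [hE1, hE2]
    split_ifs with h
    · rw [← Fintype.prod_equiv e.symm (fun p => φ (e.symm p) (y (e.symm p))) (fun j => φ j (y j)) (fun _ => rfl),
        Fintype.prod_sum_type]
    · rw [zero_mul]
  simp_rw [hinner, norm_mul, mul_pow, norm_prod, ← prod_pow]
  rw [← sum_mul, mul_comm]

end Idle

/-! ### The active coins of a block: transport to the read-out identity -/

section Active

variable {b : ℕ} {J Ω : Type*} [Fintype J] [DecidableEq J] [Fintype Ω] [DecidableEq Ω]

/-- **The active coins of a period-finding block obey the read-out identity.** With the active
coins presented as offsets `Fin b` and controls `J`, the offset factors `(-1)^{x_t γ_t}`, control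
factors `χ_j`, and the fibre map `G((x + A(y)) mod 2^b)`: summed over the offset read-out, the
fibre norm-sums are the mixture `∑_u S_G(u) |Φ(u)|²` (`readout_identity`).
[cite: Kitaev1995, §3 (Remark 8, Lemma 8) and §4] [cite: Shor1997, §5] -/
theorem sum_fiber_norm_sq_active (e : J → ℕ) (χ : J → Bool → ℂ) (G : ℕ → Ω) :
    ∑ γT : Fin b → Bool, ∑ ω : Ω, ‖∑ ya ∈ univ.filter (fun ya : (Fin b ⊕ J) → Bool =>
        G ((Nat.ofBits (fun t => ya (Sum.inl t)) + expo e (fun j => ya (Sum.inr j))) % 2 ^ b) = ω),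
        (∏ t : Fin b, (if ya (Sum.inl t) && γT t then (-1 : ℂ) else 1)) * ∏ j, χ j (ya (Sum.inr j))‖ ^ 2 =
      ∑ u ∈ range (2 ^ b), fiberSum (2 ^ b) G u * ‖testProd (2 ^ b) e χ u‖ ^ 2 := by
  classical
  rw [← readout_identity e χ G]
  refine sum_congr rfl fun γT _ => sum_congr rfl fun ω _ => ?_
  congr 2
  rw [sum_filter]
  calc (∑ ya : Fin b ⊕ J → Bool, if G ((Nat.ofBits (fun t => ya (Sum.inl t)) + expo e (fun j => ya (Sum.inr j))) % 2 ^ b) = ω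
        then (∏ t : Fin b, (if ya (Sum.inl t) && γT t then (-1 : ℂ) else 1)) * ∏ j, χ j (ya (Sum.inr j)) else 0)
      = ∑ p : (Fin b → Bool) × (J → Bool), (if G ((Nat.ofBits p.1 + expo e p.2) % 2 ^ b) = ω
          then ySign p.1 γT * ∏ j, χ j (p.2 j) else 0) :=
        Fintype.sum_equiv (Equiv.sumArrowEquivProdArrow (Fin b) J Bool) _ _ fun ya => rfl
    _ = _ := Fintype.sum_prod_type' fun (x : Fin b → Bool) (y : J → Bool) =>
        if G ((Nat.ofBits x + expo e y) % 2 ^ b) = ω then ySign x γT * ∏ j, χ j (y j) else 0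

/-- The same with Kitaev's read-out factors on the controls: the mixture of the products of the
single-test probabilities. [cite: Kitaev1995, §3 Remark 8] -/
theorem sum_fiber_norm_sq_active_signChar (e : J → ℕ) (γC σ : J → Bool) (G : ℕ → Ω) :
    ∑ γT : Fin b → Bool, ∑ ω : Ω, ‖∑ ya ∈ univ.filter (fun ya : (Fin b ⊕ J) → Bool =>
        G ((Nat.ofBits (fun t => ya (Sum.inl t)) + expo e (fun j => ya (Sum.inr j))) % 2 ^ b) = ω),
        (∏ t : Fin b, (if ya (Sum.inl t) && γT t then (-1 : ℂ) else 1)) * ∏ j, signChar γC σ j (ya (Sum.inr j))‖ ^ 2 =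
      ∑ u ∈ range (2 ^ b), fiberSum (2 ^ b) G u *
        (4 ^ Fintype.card J * ∏ j, testWeight (γC j) (σ j) (2 * Real.pi * u * 2 ^ e j / 2 ^ b)) := by
  rw [sum_fiber_norm_sq_active]
  refine sum_congr rfl fun u _ => ?_
  rw [norm_sq_testProd_signChar]
  push_cast
  ring

end Active

end PeriodFinding

end Literature.Computability.QuantumComplexity

end
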